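import Summits.AnomalousDissipation.AnomalousDissipation.Theorems.MarginalStabilityChainStrainedLayerLawStubVorticityUniformBoundsP

/-!
# Stub `stub_vorticityUniformBounds` (crux stmt-AnomalousDissipation-3007, line `strain-work-sum-rule`) — tools R:
# the first-moment balance at one instant

Support file (`--supports stmt-AnomalousDissipation-3007`; registered sub-goal `stub_vorticityUniformBounds_momentSlice`).
With the weight `φ = √(1 + y²)` (tools P) and a cutoff `0 ≤ ψ ≤ 1` of compact `y`-support, the weighted Kato balance with
`θ = φψ` gives
`∫∫ j_ε′(ω)φψ(∂ₓb − ∂_ya) ≤ −∫∫ j_ε(ω)φψ + ∫∫(|ω|+ε)|v|ψ + (1+ν)∫∫(|ω|+ε)ψ + ν∫∫(|ω|+ε)|ψ′|`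
`  + ∫∫(|ω|+ε)|v|φ|ψ′| + ∫∫(|ω|+ε)|y|φ|ψ′| + ν∫∫|∂_yω|φ|ψ′|`:
the compression `−yφ′ = −(φ − 1/φ)` returns the functional with a minus sign (confinement by the strain), and the
viscous flux along `φ′ψ` is integrated by parts once more (`|φ″| ≤ 1`). All `[folklore]`.
-/

-- `Summit.<Summit>.<Problem>` is the tree's mandated summit-side namespace (CONVENTIONS §2); for this
-- single-conjunct summit the two coincide, so the duplicate is deliberate.
set_option linter.dupNamespace false

noncomputable section

open scoped Topology ENNReal
open Filter Set Function MeasureTheory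

namespace Summit.AnomalousDissipation.AnomalousDissipation.Theorems.StrainedLayerLaw.StrainWorkSumRule

open Literature.Analysis.FluidPDE Literature.Analysis.FluidPDE.StretchedLayer
open Summit.AnomalousDissipation.AnomalousDissipation.Theorems.MarginalStabilityChainStretchedVortexRows

/-! ## The moment balance at one instant -/

section MomentSlice

/-- **The first-moment inequality at one instant (registered sub-goal `stub_vorticityUniformBounds_momentSlice`).**
In the setting of tools D, for `ε > 0`, `ν ≥ 0`, a cutoff `ψ ∈ C¹` with `0 ≤ ψ ≤ 1` vanishing for `|y| ≥ R′`, and the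
weight `φ = √(1 + y²)`: the weighted Kato balance (tools P) with `θ = φψ` gives
`∫∫ j_ε′(ω)φψ(∂ₓb − ∂_ya) ≤ −∫∫ j_ε(ω)φψ + ∫∫(|ω|+ε)|v|ψ + (1+ν)∫∫(|ω|+ε)ψ + ν∫∫(|ω|+ε)|ψ′|`
`  + ∫∫(|ω|+ε)|v|φ|ψ′| + ∫∫(|ω|+ε)|y|φ|ψ′| + ν∫∫|∂_yω|φ|ψ′|`
— the compression `−yφ′ = −(φ − 1/φ)` returns the functional with a minus sign; the viscous term along `φ′ψ` is
integrated by parts once more (`|φ″| ≤ 1`). The last four terms only see the transition region of the cutoff.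
[folklore] -/
theorem stub_vorticityUniformBounds_momentSlice : ∀ (L ν R ε : ℝ) (u v p a b : ℝ → ℝ → ℝ) (ψ : ℝ → ℝ),
    0 < L → 0 ≤ ν → 0 < ε →
    ContDiff ℝ 2 (fun q : ℝ × ℝ => u q.1 q.2) → ContDiff ℝ 2 (fun q : ℝ × ℝ => v q.1 q.2) →
    ContDiff ℝ 1 (fun q : ℝ × ℝ => p q.1 q.2) → ContDiff ℝ 1 (fun q : ℝ × ℝ => a q.1 q.2) →
    ContDiff ℝ 1 (fun q : ℝ × ℝ => b q.1 q.2) →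
    (∀ x y, a x y + u x y * dX u x y + (v x y - y) * dY u x y = -dX p x y + ν * lap u x y) →
    (∀ x y, b x y + u x y * dX v x y + (v x y - y) * dY v x y - v x y = -dY p x y + ν * lap v x y) →
    (∀ x y, dX u x y + dY v x y = 0) →
    (∀ x y, u (x + L) y = u x y) → (∀ x y, v (x + L) y = v x y) → (∀ x y, p (x + L) y = p x y) →
    (∀ x y, b (x + L) y = b x y) →
    ContDiff ℝ 1 ψ → (∀ y, 0 ≤ ψ y) → (∀ y, ψ y ≤ 1) → (∀ y, R ≤ |y| → ψ y = 0) →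
      ∫ q in Ioc 0 L ×ˢ univ, vorticity u v q.1 q.2 / Real.sqrt (vorticity u v q.1 q.2 ^ 2 + ε ^ 2) *
          (Real.sqrt (1 + q.2 ^ 2) * ψ q.2) * (dX b q.1 q.2 - dY a q.1 q.2) ≤
        -(∫ q in Ioc 0 L ×ˢ univ, Real.sqrt (vorticity u v q.1 q.2 ^ 2 + ε ^ 2) * Real.sqrt (1 + q.2 ^ 2) * ψ q.2) +
        (∫ q in Ioc 0 L ×ˢ univ, (|vorticity u v q.1 q.2| + ε) * |v q.1 q.2| * ψ q.2) +
        (1 + ν) * (∫ q in Ioc 0 L ×ˢ univ, (|vorticity u v q.1 q.2| + ε) * ψ q.2) +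
        ν * (∫ q in Ioc 0 L ×ˢ univ, (|vorticity u v q.1 q.2| + ε) * |deriv ψ q.2|) +
        (∫ q in Ioc 0 L ×ˢ univ, (|vorticity u v q.1 q.2| + ε) * |v q.1 q.2| * Real.sqrt (1 + q.2 ^ 2) * |deriv ψ q.2|) +
        (∫ q in Ioc 0 L ×ˢ univ, (|vorticity u v q.1 q.2| + ε) * |q.2| * Real.sqrt (1 + q.2 ^ 2) * |deriv ψ q.2|) +
        ν * (∫ q in Ioc 0 L ×ˢ univ, |dY (vorticity u v) q.1 q.2| * Real.sqrt (1 + q.2 ^ 2) * |deriv ψ q.2|) := by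
  obtain ⟨kato_sq_add_sq_pos, kato_sqrt_pos, kato_le_sqrt, kato_abs_le_sqrt, kato_sqrt_le, kato_abs_jprime_le_one,
    kato_jsecond_nonneg, kato_G_nonpos, kato_mul_jprime_sub_G, kato_hasDerivAt_j, kato_hasDerivAt_jprime,
    kato_hasDerivAt_G⟩ := kato_modulus_props
  intro L ν R ε u v p a b ψ hL hν hε hu hv hp ha hb hmx hmy hdiv huper hvper hpper hbper hψ hψ0 hψ1 hψR
  obtain ⟨kato_phi_pos, kato_abs_le_phi, kato_phi_le, kato_abs_phi'_le, kato_phi''_le, kato_mul_phi', kato_phi_contDiff,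
    kato_phi'_contDiff, kato_phi_ge_one, kato_phi_sq, kato_hasDerivAt_phi, kato_hasDerivAt_phi'⟩ := kato_phi_props
  set ω : ℝ → ℝ → ℝ := vorticity u v with hωdef
  set φ : ℝ → ℝ := fun y => Real.sqrt (1 + y ^ 2) with hφdef
  set φ' : ℝ → ℝ := fun y => y / Real.sqrt (1 + y ^ 2) with hφ'def
  set φ'' : ℝ → ℝ := fun y => 1 / Real.sqrt (1 + y ^ 2) ^ 3 with hφ''def
  set θ : ℝ → ℝ := fun y => φ y * ψ y with hθdef
  set j : ℝ → ℝ := fun s => Real.sqrt (s ^ 2 + ε ^ 2) with hj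
  set jp : ℝ → ℝ := fun s => s / Real.sqrt (s ^ 2 + ε ^ 2) with hjp
  -- regularity
  have hu1 : ContDiff ℝ 1 (fun q : ℝ × ℝ => u q.1 q.2) := hu.of_le one_le_two
  have hv1 : ContDiff ℝ 1 (fun q : ℝ × ℝ => v q.1 q.2) := hv.of_le one_le_two
  have hω1 : ContDiff ℝ 1 (fun q : ℝ × ℝ => ω q.1 q.2) := contDiff_one_vorticity hu hv
  have hφ : ContDiff ℝ 1 φ := kato_phi_contDiff
  have hφ'c : ContDiff ℝ 1 φ' := kato_phi'_contDiff
  have hθ : ContDiff ℝ 1 θ := hφ.mul hψ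
  have hφd : ∀ y, HasDerivAt φ (φ' y) y := fun y => kato_hasDerivAt_phi y
  have hφ'd : ∀ y, HasDerivAt φ' (φ'' y) y := fun y => kato_hasDerivAt_phi' y
  have hψd : ∀ y, HasDerivAt ψ (deriv ψ y) y := fun y => (hψ.differentiable one_ne_zero y).hasDerivAt
  have hθd : ∀ y, deriv θ y = φ' y * ψ y + φ y * deriv ψ y := fun y => ((hφd y).mul (hψd y)).deriv
  have hθR : ∀ y, R ≤ |y| → θ y = 0 := fun y hy => by simp only [hθdef, hψR y hy, mul_zero]
  have hψ'0 : ∀ y, R + 1 ≤ |y| → deriv ψ y = 0 := fun y hy =>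
    kato_dY_eq_zero (Φ := fun _ s => ψ s) (x := (0:ℝ)) (fun _ s hs => hψR s hs) hy
  have cψ : Continuous ψ := hψ.continuous
  have cψ' : Continuous (deriv ψ) := hψ.continuous_deriv le_rfl
  have cφ : Continuous φ := hφ.continuous
  have cφ' : Continuous φ' := hφ'c.continuous
  have cφ'' : Continuous φ'' := by
    simp only [hφ''def]; exact continuous_const.div (cφ.pow 3) fun y => (pow_pos (kato_phi_pos y) 3).ne'
  have cω : Continuous fun q : ℝ × ℝ => ω q.1 q.2 := hω1.continuous
  have cωy : Continuous fun q : ℝ × ℝ => dY ω q.1 q.2 := continuous_dY hω1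
  have cv : Continuous fun q : ℝ × ℝ => v q.1 q.2 := hv.continuous
  have cj : Continuous j := Real.continuous_sqrt.comp (by fun_prop)
  have cjp : Continuous jp := continuous_id.div cj fun s => (kato_sqrt_pos hε s).ne'
  -- pointwise facts about `j`
  have hjle : ∀ s, j s ≤ |s| + ε := fun s => kato_sqrt_le hε s
  have hj0 : ∀ s, 0 ≤ j s := fun s => (kato_sqrt_pos hε s).le
  have hjp1 : ∀ s, |jp s| ≤ 1 := fun s => kato_abs_jprime_le_one hε s
  -- the weighted balance with `θ = φψ`
  have key := stub_vorticityUniformBounds_katoWeighted L ν R ε u v p a b θ hL hε hu hv hp ha hb hmx hmy hdiv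
    huper hvper hpper hbper hθ hθR
  rw [show (fun q : ℝ × ℝ => vorticity u v q.1 q.2 / Real.sqrt (vorticity u v q.1 q.2 ^ 2 + ε ^ 2) *
      (Real.sqrt (1 + q.2 ^ 2) * ψ q.2) * (dX b q.1 q.2 - dY a q.1 q.2)) =
    fun q : ℝ × ℝ => vorticity u v q.1 q.2 / Real.sqrt (vorticity u v q.1 q.2 ^ 2 + ε ^ 2) * θ q.2 *
      (dX b q.1 q.2 - dY a q.1 q.2) from rfl, key]
  simp only [hθd]
  -- integrability helpers
  have hS : MeasurableSet (Ioc (0:ℝ) L ×ˢ (univ : Set ℝ)) := measurableSet_Ioc.prod MeasurableSet.univ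
  have hIψ : ∀ F : ℝ × ℝ → ℝ, Continuous F → IntegrableOn (fun q : ℝ × ℝ => F q * ψ q.2) (Ioc 0 L ×ˢ univ) :=
    fun F hF => kato_integrableOn_strip_of_eq_zero (R := R) (hF.mul (cψ.comp continuous_snd))
      fun x _ y hy => by simp only [hψR y hy, mul_zero]
  have hIψ' : ∀ F : ℝ × ℝ → ℝ, Continuous F → IntegrableOn (fun q : ℝ × ℝ => F q * deriv ψ q.2) (Ioc 0 L ×ˢ univ) :=
    fun F hF => kato_integrableOn_strip_of_eq_zero (R := R + 1) (hF.mul (cψ'.comp continuous_snd))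
      fun x _ y hy => by simp only [hψ'0 y hy, mul_zero]
  have hIaψ' : ∀ F : ℝ × ℝ → ℝ, Continuous F → IntegrableOn (fun q : ℝ × ℝ => F q * |deriv ψ q.2|) (Ioc 0 L ×ˢ univ) :=
    fun F hF => kato_integrableOn_strip_of_eq_zero (R := R + 1) (hF.mul ((cψ'.comp continuous_snd).abs))
      fun x _ y hy => by simp only [hψ'0 y hy, abs_zero, mul_zero]
  ------------------------------------------------------------------
  -- (i) `∫ G θ ≤ 0`, (ii) `−ν ∫ j″|∇ω|²θ ≤ 0`
  ------------------------------------------------------------------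
  have hθ0 : ∀ y, 0 ≤ θ y := fun y => mul_nonneg (kato_phi_pos y).le (hψ0 y)
  have e_i : ∫ q in Ioc 0 L ×ˢ univ, -ε ^ 2 / Real.sqrt (ω q.1 q.2 ^ 2 + ε ^ 2) * θ q.2 ≤ 0 :=
    integral_nonpos fun q => mul_nonpos_of_nonpos_of_nonneg (kato_G_nonpos hε _) (hθ0 _)
  have e_ii : 0 ≤ ∫ q in Ioc 0 L ×ˢ univ, ε ^ 2 / ((ω q.1 q.2 ^ 2 + ε ^ 2) * Real.sqrt (ω q.1 q.2 ^ 2 + ε ^ 2)) *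
      (dX ω q.1 q.2 ^ 2 + dY ω q.1 q.2 ^ 2) * θ q.2 :=
    integral_nonneg fun q => mul_nonneg (mul_nonneg (kato_jsecond_nonneg hε _) (by positivity)) (hθ0 _)
  ------------------------------------------------------------------
  -- (iii) the transport term `∫ j(ω)(v − y)(φ′ψ + φψ′)`
  ------------------------------------------------------------------
  have i_a : IntegrableOn (fun q : ℝ × ℝ => j (ω q.1 q.2) * v q.1 q.2 * φ' q.2 * ψ q.2) (Ioc 0 L ×ˢ univ) :=
    hIψ (fun q => j (ω q.1 q.2) * v q.1 q.2 * φ' q.2) (by fun_prop)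
  have i_b : IntegrableOn (fun q : ℝ × ℝ => j (ω q.1 q.2) * v q.1 q.2 * φ q.2 * deriv ψ q.2) (Ioc 0 L ×ˢ univ) :=
    hIψ' (fun q => j (ω q.1 q.2) * v q.1 q.2 * φ q.2) (by fun_prop)
  have i_c : IntegrableOn (fun q : ℝ × ℝ => j (ω q.1 q.2) * q.2 * φ' q.2 * ψ q.2) (Ioc 0 L ×ˢ univ) :=
    hIψ (fun q => j (ω q.1 q.2) * q.2 * φ' q.2) (by fun_prop)
  have i_d : IntegrableOn (fun q : ℝ × ℝ => j (ω q.1 q.2) * q.2 * φ q.2 * deriv ψ q.2) (Ioc 0 L ×ˢ univ) :=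
    hIψ' (fun q => j (ω q.1 q.2) * q.2 * φ q.2) (by fun_prop)
  have e_split : ∫ q in Ioc 0 L ×ˢ univ, Real.sqrt (ω q.1 q.2 ^ 2 + ε ^ 2) * (v q.1 q.2 - q.2) *
      (φ' q.2 * ψ q.2 + φ q.2 * deriv ψ q.2) =
      (∫ q in Ioc 0 L ×ˢ univ, j (ω q.1 q.2) * v q.1 q.2 * φ' q.2 * ψ q.2) +
      (∫ q in Ioc 0 L ×ˢ univ, j (ω q.1 q.2) * v q.1 q.2 * φ q.2 * deriv ψ q.2) -
      (∫ q in Ioc 0 L ×ˢ univ, j (ω q.1 q.2) * q.2 * φ' q.2 * ψ q.2) -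
      (∫ q in Ioc 0 L ×ˢ univ, j (ω q.1 q.2) * q.2 * φ q.2 * deriv ψ q.2) := by
    have i_ab : IntegrableOn (fun q : ℝ × ℝ => j (ω q.1 q.2) * v q.1 q.2 * φ' q.2 * ψ q.2 +
        j (ω q.1 q.2) * v q.1 q.2 * φ q.2 * deriv ψ q.2) (Ioc 0 L ×ˢ univ) := i_a.add i_b
    have i_abc : IntegrableOn (fun q : ℝ × ℝ => j (ω q.1 q.2) * v q.1 q.2 * φ' q.2 * ψ q.2 +
        j (ω q.1 q.2) * v q.1 q.2 * φ q.2 * deriv ψ q.2 - j (ω q.1 q.2) * q.2 * φ' q.2 * ψ q.2) (Ioc 0 L ×ˢ univ) :=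
      i_ab.sub i_c
    rw [← integral_add i_a i_b, ← integral_sub i_ab i_c, ← integral_sub i_abc i_d]
    refine integral_congr_ae (Eventually.of_forall fun q => ?_)
    simp only [hj]
    ring
  -- (iii-a)
  have e_a : ∫ q in Ioc 0 L ×ˢ univ, j (ω q.1 q.2) * v q.1 q.2 * φ' q.2 * ψ q.2 ≤
      ∫ q in Ioc 0 L ×ˢ univ, (|ω q.1 q.2| + ε) * |v q.1 q.2| * ψ q.2 := by
    refine integral_mono i_a (hIψ (fun q => (|ω q.1 q.2| + ε) * |v q.1 q.2|) (by fun_prop)) fun q => ?_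
    simp only
    have h1 := hjle (ω q.1 q.2); have h2 := kato_abs_phi'_le q.2; have h3 := hψ0 q.2; have h4 := hj0 (ω q.1 q.2)
    have h5 : j (ω q.1 q.2) * v q.1 q.2 * φ' q.2 ≤ (|ω q.1 q.2| + ε) * |v q.1 q.2| := by
      calc j (ω q.1 q.2) * v q.1 q.2 * φ' q.2 ≤ |j (ω q.1 q.2) * v q.1 q.2 * φ' q.2| := le_abs_self _
        _ = j (ω q.1 q.2) * |v q.1 q.2| * |φ' q.2| := by rw [abs_mul, abs_mul, abs_of_nonneg h4]
        _ ≤ (|ω q.1 q.2| + ε) * |v q.1 q.2| * 1 := mul_le_mul (mul_le_mul_of_nonneg_right h1 (abs_nonneg _)) h2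
            (abs_nonneg _) (by positivity)
        _ = _ := mul_one _
    exact mul_le_mul_of_nonneg_right h5 h3
  -- (iii-b)
  have e_b : ∫ q in Ioc 0 L ×ˢ univ, j (ω q.1 q.2) * v q.1 q.2 * φ q.2 * deriv ψ q.2 ≤
      ∫ q in Ioc 0 L ×ˢ univ, (|ω q.1 q.2| + ε) * |v q.1 q.2| * Real.sqrt (1 + q.2 ^ 2) * |deriv ψ q.2| := by
    refine integral_mono i_b (hIaψ' (fun q => (|ω q.1 q.2| + ε) * |v q.1 q.2| * Real.sqrt (1 + q.2 ^ 2)) (by fun_prop))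
      fun q => ?_
    simp only [hφdef]
    have h1 := hjle (ω q.1 q.2); have h4 := hj0 (ω q.1 q.2); have hφ0 := (kato_phi_pos q.2).le
    calc j (ω q.1 q.2) * v q.1 q.2 * Real.sqrt (1 + q.2 ^ 2) * deriv ψ q.2 ≤
        |j (ω q.1 q.2) * v q.1 q.2 * Real.sqrt (1 + q.2 ^ 2) * deriv ψ q.2| := le_abs_self _
      _ = j (ω q.1 q.2) * |v q.1 q.2| * Real.sqrt (1 + q.2 ^ 2) * |deriv ψ q.2| := by
          rw [abs_mul, abs_mul, abs_mul, abs_of_nonneg h4, abs_of_nonneg hφ0]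
      _ ≤ (|ω q.1 q.2| + ε) * |v q.1 q.2| * Real.sqrt (1 + q.2 ^ 2) * |deriv ψ q.2| := by
          gcongr
  -- (iii-c): the compression returns `−∫ jφψ`, up to `∫ jψ/φ ≤ ∫ (|ω|+ε)ψ`
  have e_c : -(∫ q in Ioc 0 L ×ˢ univ, j (ω q.1 q.2) * q.2 * φ' q.2 * ψ q.2) ≤
      -(∫ q in Ioc 0 L ×ˢ univ, Real.sqrt (ω q.1 q.2 ^ 2 + ε ^ 2) * Real.sqrt (1 + q.2 ^ 2) * ψ q.2) +
        ∫ q in Ioc 0 L ×ˢ univ, (|ω q.1 q.2| + ε) * ψ q.2 := by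
    have i1 : IntegrableOn (fun q : ℝ × ℝ => Real.sqrt (ω q.1 q.2 ^ 2 + ε ^ 2) * Real.sqrt (1 + q.2 ^ 2) * ψ q.2)
        (Ioc 0 L ×ˢ univ) := hIψ (fun q => Real.sqrt (ω q.1 q.2 ^ 2 + ε ^ 2) * Real.sqrt (1 + q.2 ^ 2)) (by fun_prop)
    have i2 : IntegrableOn (fun q : ℝ × ℝ => (|ω q.1 q.2| + ε) * ψ q.2) (Ioc 0 L ×ˢ univ) :=
      hIψ (fun q => |ω q.1 q.2| + ε) (by fun_prop)
    have i1n : IntegrableOn (fun q : ℝ × ℝ => -(Real.sqrt (ω q.1 q.2 ^ 2 + ε ^ 2) * Real.sqrt (1 + q.2 ^ 2) * ψ q.2))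
        (Ioc 0 L ×ˢ univ) := i1.neg
    have i12 : IntegrableOn (fun q : ℝ × ℝ => -(Real.sqrt (ω q.1 q.2 ^ 2 + ε ^ 2) * Real.sqrt (1 + q.2 ^ 2) * ψ q.2) +
        (|ω q.1 q.2| + ε) * ψ q.2) (Ioc 0 L ×ˢ univ) := i1n.add i2
    rw [← integral_neg, ← integral_neg, ← integral_add i1n i2]
    refine integral_mono i_c.neg i12 fun q => ?_
    simp only [hφ'def, hj]
    have hm := kato_mul_phi' q.2
    have hφ1 := kato_phi_ge_one q.2; have hφ0 := kato_phi_pos q.2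
    have h1 := hjle (ω q.1 q.2); have h4 := hj0 (ω q.1 q.2); have h3 := hψ0 q.2
    simp only [hj] at h1 h4
    -- `−j·(yφ′)ψ = −jφψ + (j/φ)ψ ≤ −jφψ + (|ω|+ε)ψ`
    have h5 : Real.sqrt (ω q.1 q.2 ^ 2 + ε ^ 2) * (1 / Real.sqrt (1 + q.2 ^ 2)) ≤ |ω q.1 q.2| + ε := by
      calc Real.sqrt (ω q.1 q.2 ^ 2 + ε ^ 2) * (1 / Real.sqrt (1 + q.2 ^ 2)) ≤ Real.sqrt (ω q.1 q.2 ^ 2 + ε ^ 2) * 1 :=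
            mul_le_mul_of_nonneg_left (by rw [div_le_one hφ0]; exact hφ1) h4
        _ ≤ |ω q.1 q.2| + ε := by rw [mul_one]; exact h1
    have e : -(Real.sqrt (ω q.1 q.2 ^ 2 + ε ^ 2) * q.2 * (q.2 / Real.sqrt (1 + q.2 ^ 2)) * ψ q.2) =
        -(Real.sqrt (ω q.1 q.2 ^ 2 + ε ^ 2) * Real.sqrt (1 + q.2 ^ 2) * ψ q.2) +
          Real.sqrt (ω q.1 q.2 ^ 2 + ε ^ 2) * (1 / Real.sqrt (1 + q.2 ^ 2)) * ψ q.2 := by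
      rw [show Real.sqrt (ω q.1 q.2 ^ 2 + ε ^ 2) * q.2 * (q.2 / Real.sqrt (1 + q.2 ^ 2)) =
        Real.sqrt (ω q.1 q.2 ^ 2 + ε ^ 2) * (q.2 * (q.2 / Real.sqrt (1 + q.2 ^ 2))) by ring, hm]
      ring
    rw [e]
    nlinarith [mul_le_mul_of_nonneg_right h5 h3]
  -- (iii-d)
  have e_d : -(∫ q in Ioc 0 L ×ˢ univ, j (ω q.1 q.2) * q.2 * φ q.2 * deriv ψ q.2) ≤
      ∫ q in Ioc 0 L ×ˢ univ, (|ω q.1 q.2| + ε) * |q.2| * Real.sqrt (1 + q.2 ^ 2) * |deriv ψ q.2| := by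
    rw [← integral_neg]
    refine integral_mono i_d.neg (hIaψ' (fun q => (|ω q.1 q.2| + ε) * |q.2| * Real.sqrt (1 + q.2 ^ 2)) (by fun_prop))
      fun q => ?_
    simp only [hφdef]
    have h1 := hjle (ω q.1 q.2); have h4 := hj0 (ω q.1 q.2); have hφ0 := (kato_phi_pos q.2).le
    calc -(j (ω q.1 q.2) * q.2 * Real.sqrt (1 + q.2 ^ 2) * deriv ψ q.2) ≤
        |j (ω q.1 q.2) * q.2 * Real.sqrt (1 + q.2 ^ 2) * deriv ψ q.2| := neg_le_abs _
      _ = j (ω q.1 q.2) * |q.2| * Real.sqrt (1 + q.2 ^ 2) * |deriv ψ q.2| := by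
          rw [abs_mul, abs_mul, abs_mul, abs_of_nonneg h4, abs_of_nonneg hφ0]
      _ ≤ (|ω q.1 q.2| + ε) * |q.2| * Real.sqrt (1 + q.2 ^ 2) * |deriv ψ q.2| := by gcongr
  ------------------------------------------------------------------
  -- (iv) the viscous flux `−ν∫ j′(ω) ω_y (φ′ψ + φψ′)`
  ------------------------------------------------------------------
  have hωy : ∀ x y, HasDerivAt (fun s => ω x s) (dY ω x y) y := hasDerivAt_dY_of_contDiff hω1 one_ne_zero
  have hjd : ∀ s, HasDerivAt j (jp s) s := fun s => kato_hasDerivAt_j hε s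
  have hjy : ∀ x y, HasDerivAt (fun s => j (ω x s)) (jp (ω x y) * dY ω x y) y := fun x y =>
    HasDerivAt.comp (h₂ := j) (h := fun s => ω x s) y (hjd (ω x y)) (hωy x y)
  have i_e : IntegrableOn (fun q : ℝ × ℝ => jp (ω q.1 q.2) * dY ω q.1 q.2 * (φ' q.2 * ψ q.2)) (Ioc 0 L ×ˢ univ) := by
    have := hIψ (fun q => jp (ω q.1 q.2) * dY ω q.1 q.2 * φ' q.2) (by fun_prop)
    exact this.congr_fun (fun q _ => by simp only; ring) hS
  have i_f : IntegrableOn (fun q : ℝ × ℝ => jp (ω q.1 q.2) * dY ω q.1 q.2 * (φ q.2 * deriv ψ q.2)) (Ioc 0 L ×ˢ univ) := by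
    have := hIψ' (fun q => jp (ω q.1 q.2) * dY ω q.1 q.2 * φ q.2) (by fun_prop)
    exact this.congr_fun (fun q _ => by simp only; ring) hS
  have e_vsplit : ∫ q in Ioc 0 L ×ˢ univ, ω q.1 q.2 / Real.sqrt (ω q.1 q.2 ^ 2 + ε ^ 2) * dY ω q.1 q.2 *
      (φ' q.2 * ψ q.2 + φ q.2 * deriv ψ q.2) =
      (∫ q in Ioc 0 L ×ˢ univ, jp (ω q.1 q.2) * dY ω q.1 q.2 * (φ' q.2 * ψ q.2)) +
        ∫ q in Ioc 0 L ×ˢ univ, jp (ω q.1 q.2) * dY ω q.1 q.2 * (φ q.2 * deriv ψ q.2) := by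
    rw [← integral_add i_e i_f]
    refine integral_congr_ae (Eventually.of_forall fun q => ?_)
    simp only [hjp]
    ring
  -- (iv-a): integrate by parts once more in `y`
  have iby : ∫ q in Ioc 0 L ×ˢ univ, (φ' q.2 * ψ q.2) * (jp (ω q.1 q.2) * dY ω q.1 q.2) =
      -∫ q in Ioc 0 L ×ˢ univ, (φ'' q.2 * ψ q.2 + φ' q.2 * deriv ψ q.2) * j (ω q.1 q.2) :=
    integral_strip_mul_dY_eq_neg (f := fun _ y => φ' y * ψ y) (g := fun x y => j (ω x y))
      (f' := fun _ y => φ'' y * ψ y + φ' y * deriv ψ y) (g' := fun x y => jp (ω x y) * dY ω x y)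
      (fun x y => (hφ'd y).mul (hψd y)) hjy
      ((hIψ (fun q => φ' q.2 * (jp (ω q.1 q.2) * dY ω q.1 q.2)) (by fun_prop)).congr_fun
        (fun q _ => by simp only; ring) hS)
      (by
        have h1 := hIψ (fun q => φ'' q.2 * j (ω q.1 q.2)) (by fun_prop)
        have h2 := hIψ' (fun q => φ' q.2 * j (ω q.1 q.2)) (by fun_prop)
        have h12 : IntegrableOn (fun q : ℝ × ℝ => φ'' q.2 * j (ω q.1 q.2) * ψ q.2 + φ' q.2 * j (ω q.1 q.2) * deriv ψ q.2)
            (Ioc 0 L ×ˢ univ) := h1.add h2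
        exact h12.congr_fun (fun q _ => by simp only; ring) hS)
      ((hIψ (fun q => φ' q.2 * j (ω q.1 q.2)) (by fun_prop)).congr_fun (fun q _ => by simp only; ring) hS)
  have e_e : -(ν * ∫ q in Ioc 0 L ×ˢ univ, jp (ω q.1 q.2) * dY ω q.1 q.2 * (φ' q.2 * ψ q.2)) ≤
      ν * (∫ q in Ioc 0 L ×ˢ univ, (|ω q.1 q.2| + ε) * ψ q.2) +
        ν * ∫ q in Ioc 0 L ×ˢ univ, (|ω q.1 q.2| + ε) * |deriv ψ q.2| := by
    have e1 : ∫ q in Ioc 0 L ×ˢ univ, jp (ω q.1 q.2) * dY ω q.1 q.2 * (φ' q.2 * ψ q.2) =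
        -∫ q in Ioc 0 L ×ˢ univ, (φ'' q.2 * ψ q.2 + φ' q.2 * deriv ψ q.2) * j (ω q.1 q.2) := by
      rw [← iby]; exact integral_congr_ae (Eventually.of_forall fun q => by simp only; ring)
    rw [e1, mul_neg, neg_neg, ← mul_add]
    refine mul_le_mul_of_nonneg_left ?_ hν
    have i1 : IntegrableOn (fun q : ℝ × ℝ => (φ'' q.2 * ψ q.2 + φ' q.2 * deriv ψ q.2) * j (ω q.1 q.2)) (Ioc 0 L ×ˢ univ) := by
      have h1 := hIψ (fun q => φ'' q.2 * j (ω q.1 q.2)) (by fun_prop)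
      have h2 := hIψ' (fun q => φ' q.2 * j (ω q.1 q.2)) (by fun_prop)
      have h12 : IntegrableOn (fun q : ℝ × ℝ => φ'' q.2 * j (ω q.1 q.2) * ψ q.2 + φ' q.2 * j (ω q.1 q.2) * deriv ψ q.2)
          (Ioc 0 L ×ˢ univ) := h1.add h2
      exact h12.congr_fun (fun q _ => by simp only; ring) hS
    have i2 : IntegrableOn (fun q : ℝ × ℝ => (|ω q.1 q.2| + ε) * ψ q.2) (Ioc 0 L ×ˢ univ) := hIψ _ (by fun_prop)
    have i3 : IntegrableOn (fun q : ℝ × ℝ => (|ω q.1 q.2| + ε) * |deriv ψ q.2|) (Ioc 0 L ×ˢ univ) := hIaψ' _ (by fun_prop)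
    rw [← integral_add i2 i3]
    refine integral_mono i1 (i2.add i3) fun q => ?_
    simp only
    have h1 := hjle (ω q.1 q.2); have h4 := hj0 (ω q.1 q.2); have h3 := hψ0 q.2
    have h6 : |φ'' q.2| ≤ 1 := kato_phi''_le q.2
    have h7 : |φ' q.2| ≤ 1 := kato_abs_phi'_le q.2
    calc (φ'' q.2 * ψ q.2 + φ' q.2 * deriv ψ q.2) * j (ω q.1 q.2) ≤
        |(φ'' q.2 * ψ q.2 + φ' q.2 * deriv ψ q.2) * j (ω q.1 q.2)| := le_abs_self _
      _ ≤ (|φ'' q.2| * ψ q.2 + |φ' q.2| * |deriv ψ q.2|) * j (ω q.1 q.2) := by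
          rw [abs_mul, abs_of_nonneg h4]
          refine mul_le_mul_of_nonneg_right ((abs_add_le _ _).trans (add_le_add ?_ ?_)) h4
          · rw [abs_mul, abs_of_nonneg h3]
          · rw [abs_mul]
      _ ≤ (1 * ψ q.2 + 1 * |deriv ψ q.2|) * (|ω q.1 q.2| + ε) := by
          refine mul_le_mul (add_le_add (mul_le_mul_of_nonneg_right h6 h3)
            (mul_le_mul_of_nonneg_right h7 (abs_nonneg _))) h1 h4 (by positivity)
      _ = (|ω q.1 q.2| + ε) * ψ q.2 + (|ω q.1 q.2| + ε) * |deriv ψ q.2| := by ring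
  -- (iv-b)
  have e_f : -(ν * ∫ q in Ioc 0 L ×ˢ univ, jp (ω q.1 q.2) * dY ω q.1 q.2 * (φ q.2 * deriv ψ q.2)) ≤
      ν * ∫ q in Ioc 0 L ×ˢ univ, |dY ω q.1 q.2| * Real.sqrt (1 + q.2 ^ 2) * |deriv ψ q.2| := by
    rw [← mul_neg, ← integral_neg]
    refine mul_le_mul_of_nonneg_left (integral_mono i_f.neg
      (hIaψ' (fun q => |dY ω q.1 q.2| * Real.sqrt (1 + q.2 ^ 2)) (by fun_prop)) fun q => ?_) hν
    simp only [hφdef]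
    have hφ0 := (kato_phi_pos q.2).le; have h5 := hjp1 (ω q.1 q.2)
    calc -(jp (ω q.1 q.2) * dY ω q.1 q.2 * (Real.sqrt (1 + q.2 ^ 2) * deriv ψ q.2)) ≤
        |jp (ω q.1 q.2) * dY ω q.1 q.2 * (Real.sqrt (1 + q.2 ^ 2) * deriv ψ q.2)| := neg_le_abs _
      _ = |jp (ω q.1 q.2)| * |dY ω q.1 q.2| * (Real.sqrt (1 + q.2 ^ 2) * |deriv ψ q.2|) := by
          rw [abs_mul, abs_mul, abs_mul, abs_of_nonneg hφ0]
      _ ≤ 1 * |dY ω q.1 q.2| * (Real.sqrt (1 + q.2 ^ 2) * |deriv ψ q.2|) := by gcongr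
      _ = |dY ω q.1 q.2| * Real.sqrt (1 + q.2 ^ 2) * |deriv ψ q.2| := by ring
  -- assemble
  rw [e_split, e_vsplit]
  nlinarith [e_i, e_ii, e_a, e_b, e_c, e_d, e_e, e_f, hν]

end MomentSlice

end Summit.AnomalousDissipation.AnomalousDissipation.Theorems.StrainedLayerLaw.StrainWorkSumRule

end
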